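import Summits.BirchSwinnertonDyer.BirchSwinnertonDyer.Theorems.SemiOrdinaryEisensteinDescentWildSplitEisensteinValueAtOneVIndexCurrency
import Summits.BirchSwinnertonDyer.BirchSwinnertonDyer.Theorems.SemiOrdinaryEisensteinDescentWildSplitEisensteinValueAtOneVCertificateRoadModP
import Summits.BirchSwinnertonDyer.BirchSwinnertonDyer.Theorems.SemiOrdinaryEisensteinDescentWildSplitEisensteinValueAtOneVNecessityOfPrint
import Summits.BirchSwinnertonDyer.BirchSwinnertonDyer.Theorems.SemiOrdinaryEisensteinDescentWildSplitEisensteinValueAtOneVLowerHalf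
import Summits.BirchSwinnertonDyer.BirchSwinnertonDyer.Theorems.UniversalToricDescentPoitouTateSelmerStructureDualityFact
import Summits.BirchSwinnertonDyer.BirchSwinnertonDyer.Theorems.UniversalToricDescentPoitouTateShaTateDualFact
import Summits.BirchSwinnertonDyer.BirchSwinnertonDyer.Theorems.SemiOrdinaryEisensteinDescentEisensteinKernelAtThreeOfValueAtOneVSlim
import HarnessLib

/-!
# Route `SemiOrdinaryEisensteinDescent`, crux #2″ `WildSplitEisensteinValueAtOneV` (stmt-BirchSwinnertonDyer-26610, `E_𝟙^V`):
# the E-lineage's conditional theorems with EVERY Poitou–Tate binder discharged (PT1, PT2 and crux C are tree theorems)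
# (cell `pub/bsd-wall`, width seat `bsd-wall-soed-p1-w3` g17, `--supports stmt-BirchSwinnertonDyer-26610`, helper)

WHY. Every conditional road the SOED E-lineage landed for crux #2″ (index currency p614377, certificate roads p621234 / p623400,
step-L normal form p615634 / p617759, ℚ-level normal form p618985) carries the Poitou–Tate dualities as displayed binders —
`PoitouTateSelmerStructureDualityFact` (PT1, item 20461) and `∀ K, poitouTate_sha_tateDual K` (PT2, item 20462, also as
`Theses.UniversalToricDescent.PoitouTateShaTateDualFact`) — and some carry the control crux C (`WildSplitControlAtThree`, 20386).
Since 2026-08-28 all three are THEOREMS of the tree: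
* PT1 — `InputsPoitouTateSelmer.semiOrdinaryEisensteinDescent_poitouTateSelmerStructureDualityFact_proof` (p625477, from
  bsd-schneider's `poitouTate_selmerStructure_duality_holds` p624636; item 20461 CLOSED·proved 10:38Z);
* PT2 — `Theorems.poitouTateShaTateDualFact_proof` / `PoitouTateShaTwoReadout.poitouTate_sha_tateDual_numberField` (p630237 /
  p629917; bsd-schneider door-c4/door-c5 + bsd-inputs k4-p1 + bsd-line-chl-p2; item 20462 CLOSED·proved 11:40Z);
* C — `UniversalToricDescentControl.semiOrdinaryEisensteinDescent_wildSplitControlAtThree_proof` (p630426; item 20386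
  CLOSED·proved 11:40Z).
This file substitutes them. WHAT IS LEFT under crux #2″ after the substitution is read off the signatures below: the research
inequality `I_FH` (`stub_indexLowerBoundFH` of the registered line `index` v3) and PRINT (the route's `PublishedInputsWildThree`,
of which only the Kolyvagin conjunct is consumed, and the refereed package `WildSplitPrintedInputsAtThree` = Hsieh Thm A ∧
BDP Thm 5.5 ∧ LZZ in the ⟹ direction) — nothing else:

* §1 `valueAtOneV_of_indexLowerBoundFH` — `PublishedInputsWildThree → I_FH → E_𝟙^V` (= the line's composition `_of` with both
  print-free stubs discharged; p614377 §2);  `indexLowerBoundFH_of_valueAtOneV` — `PUB → W → E_𝟙^V → I_FH` (p614377 §1);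
  `valueAtOneV_iff_indexLowerBoundFH` — modulo {PUB, W}: `E_𝟙^V ↔ I_FH` (p614377 §3).
* §2 `valueAtOneV_iff_stepL` — modulo {Kolyvagin, W}: `E_𝟙^V ↔ L₃ʷ°` (p617759 §3, C and PT discharged).
* §3 `valueAtOneV_of_certificates_modP` — `PUB → McCallum Cor. 5.6 (printed mod-p hypothesis, named fact) → CERT₃^FH,all → E_𝟙^V`
  (p623400 §7): on this road the only non-print input is ONE Kolyvagin point-certificate per index-excess datum.
* §4 `valueAtOneV_iff_lowerHalf` — modulo {PUB, W, Z}: `E_𝟙^V ↔ [∀ cell W, MissingLowerBoundAt W 3]` (p618985 §4);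
  `wAllExclAddWildRankOneSurj_iff_valueAtOneV_and_upperHalf` — modulo {PUB, W, Z}: rung ↔ `E_𝟙^V` ∧ upper half (p618985 §6);
  `valueAtOneV_of_wAllExclAddWildRankOneSurj` — `PUB → Z → leaf → E_𝟙^V` (necessity, p617759 §4);
  `wAllExclAddWildRankOneSurj_iff_valueAtOneV_of_binders` — modulo the route's remaining `closes` content {PUB, Prims 25896,
  J‴ 25898, W, Z}: rung ↔ `E_𝟙^V` (p617759 §5 ⇒ / soed-p2-w3 g6's slim six-binder kernel ⇐; Jetchev max-form 25897 ✓ consumed inside).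

HONEST FRAMING: one-line substitutions, THEOREMS ONLY; every remaining conjectural statement (I_FH, L₃ʷ°, the certificates,
J‴, Z, the leaf) and every print package is a displayed HYPOTHESIS; nothing is asserted about any curve; closes nothing; the
research stub I_FH is untouched and no engine for it at an additive potentially supersingular 3 is in print. BSD₃ is proved
for no curve; the Birch–Swinnerton-Dyer conjecture is NOT proved by any of this. No definition, no named fact, no `sorry`.

References: [JetchevSkinnerWan2017] Thm. 3.3.1, Prop. 3.3.4, §7.4.1 (arXiv:1512.06894 pp. 11–13, 30); [MilneADT2006] I Thm. 2.8,
4.10; [McCallumLMS1991] §5 Cor. 5.6; [GrossZagier1986] I.(6.3), (7.3); [Kolyvagin1990] Thm. A; [Miller2011LMS] Def. 1.1;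
[Castella2018] Thm. 2.3, §5.
-/

noncomputable section

open scoped Classical NumberField

set_option linter.dupNamespace false -- `Summit.BirchSwinnertonDyer.BirchSwinnertonDyer.Theorems.…` (summit = sub, D-0017)
set_option autoImplicit false

namespace Summit.BirchSwinnertonDyer.BirchSwinnertonDyer.Theorems.WildSplitEisensteinValueAtOneVPTFree

open WeierstrassCurve NumberField IsDedekindDomain Field
  Literature.NumberTheory.EllipticCurves
  Literature.NumberTheory.EllipticCurves.ModularForms
  Literature.NumberTheory.EllipticCurves.Rank1Residual
  Literature.NumberTheory.EllipticCurves.Rank1Residual.Typed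
  Literature.NumberTheory.GaloisCohomology
  Summit.BirchSwinnertonDyer.Rank1Residual
  Summit.BirchSwinnertonDyer.Rank1Residual.Additive
  Summit.BirchSwinnertonDyer.BirchSwinnertonDyer.Theses.SemiOrdinaryEisensteinDescent
  Summit.BirchSwinnertonDyer.BirchSwinnertonDyer.Theorems

/-! ### §1 Index currency, PT-free: modulo {PUB, W} the crux IS `I_FH` -/

/-- **`PublishedInputsWildThree → I_FH → WildSplitEisensteinValueAtOneV`** — the registered line `index` v3's composition with
its two remaining stubs as hypotheses and PT1/PT2 supplied by the tree (p614377 §2). CONDITIONAL on PUB (print; only the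
Kolyvagin conjunct is consumed) and on the research inequality `I_FH`; nothing asserted about any curve.
[cite: JetchevSkinnerWan2017, Thm. 3.3.1, Prop. 3.3.4 and §7.4.1 (arXiv:1512.06894 pp. 11–13, 30)] [cite: MilneADT2006, Ch. I, Thm. 4.10] -/
theorem valueAtOneV_of_indexLowerBoundFH (hF : PublishedInputsWildThree)
    (hI : ∀ (W : WeierstrassCurve ℚ) [W.IsElliptic] [W.IsGloballyMinimal] (N : ℕ) [NeZero N] (K : Type) [Field K] [NumberField K] (Dt : Literature.NumberTheory.EllipticCurves.ModularForms.ModularParametrizationData W N) (H : Literature.NumberTheory.EllipticCurves.HeegnerDatum N (NumberField.discr K)) (ι : K →+* ℂ) (P : (W.baseChange K).toAffine.Point), Summit.BirchSwinnertonDyer.Rank1Residual.Additive.ClassO6 W 3 → W.HasSurjectiveModNGaloisRep 3 → W.analyticRank = 1 → W.conductorNorm ℤ = N → Literature.NumberTheory.EllipticCurves.IsImaginaryQuadratic K → Literature.NumberTheory.EllipticCurves.SatisfiesHeegnerHypothesis N K → (W.quadraticTwist (NumberField.discr K : ℚ)).entireLFunction 1 ≠ 0 → (WeierstrassCurve.Affine.Point.map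 ι.toRatAlgHom) P = Literature.NumberTheory.EllipticCurves.ModularForms.heegnerPointComplex Dt H → ¬ IsOfFinAddOrder P → Odd (NumberField.discr K) → Summit.BirchSwinnertonDyer.BirchSwinnertonDyer.Theorems.SchneiderFree.IndexLowerBoundLeAt W 3 K P (padicValNat 3 Dt.c.natAbs)) :
    WildSplitEisensteinValueAtOneV :=
  WildSplitEisensteinValueAtOneVIndexCurrency.valueAtOneV_of_indexLowerBoundFH_of_poitouTate hF hI
    InputsPoitouTateSelmer.semiOrdinaryEisensteinDescent_poitouTateSelmerStructureDualityFact_proof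
    (fun K _ _ ↦ PoitouTateShaTwoReadout.poitouTate_sha_tateDual_numberField K)

/-- **`PublishedInputsWildThree → WildSplitPrintedInputsAtThree → WildSplitEisensteinValueAtOneV → I_FH`** (p614377 §1 with PT1
supplied by the tree). CONDITIONAL on PUB and the refereed package W; nothing asserted about any curve.
[cite: JetchevSkinnerWan2017, Thm. 3.3.1 and §7.4.1 (arXiv:1512.06894 pp. 11, 30)] [cite: LiuZhangZhang2018, Thm 1.5.1 and Thm 1.5.3] -/
theorem indexLowerBoundFH_of_valueAtOneV (hF : PublishedInputsWildThree) (hW : WildSplitPrintedInputsAtThree)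
    (hE1V : WildSplitEisensteinValueAtOneV) :
    ∀ (W : WeierstrassCurve ℚ) [W.IsElliptic] [W.IsGloballyMinimal] (N : ℕ) [NeZero N] (K : Type) [Field K] [NumberField K] (Dt : Literature.NumberTheory.EllipticCurves.ModularForms.ModularParametrizationData W N) (H : Literature.NumberTheory.EllipticCurves.HeegnerDatum N (NumberField.discr K)) (ι : K →+* ℂ) (P : (W.baseChange K).toAffine.Point), Summit.BirchSwinnertonDyer.Rank1Residual.Additive.ClassO6 W 3 → W.HasSurjectiveModNGaloisRep 3 → W.analyticRank = 1 → W.conductorNorm ℤ = N → Literature.NumberTheory.EllipticCurves.IsImaginaryQuadratic K → Literature.NumberTheory.EllipticCurves.SatisfiesHeegnerHypothesis N K → (W.quadraticTwist (NumberField.discr K : ℚ)).entireLFunction 1 ≠ 0 → (WeierstrassCurve.Affine.Point.map ι.toRatAlgHom) P = Literature.NumberTheory.EllipticCurves.ModularForms.heegnerPointComplex Dt H → ¬ IsOfFinAddOrder P → Odd (NumberField.discr K) → Summit.BirchSwinnertonDyer.BirchSwinnertonDyer.Theorems.SchneiderFree.IndexLowerBoundLeAt W 3 K P (padicValNat 3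 Dt.c.natAbs) :=
  WildSplitEisensteinValueAtOneVIndexCurrency.indexLowerBoundFH_of_valueAtOneV_of_print_of_poitouTate hF hE1V hW
    InputsPoitouTateSelmer.semiOrdinaryEisensteinDescent_poitouTateSelmerStructureDualityFact_proof

/-- **Modulo PRINT ONLY ({`PublishedInputsWildThree`, `WildSplitPrintedInputsAtThree`}): `E_𝟙^V ↔ I_FH`** — p614377 §3 with
both Poitou–Tate binders supplied by the tree. After 2026-08-28 the trust-base cost of reading crux #2″ as the plain index
inequality is print alone. Bookkeeping; nothing asserted about any curve.
[cite: JetchevSkinnerWan2017, Thm. 3.3.1 and §7.4.1 (arXiv:1512.06894 pp. 11, 30)] [cite: MilneADT2006, Ch. I, Thm. 4.10] -/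
theorem valueAtOneV_iff_indexLowerBoundFH (hF : PublishedInputsWildThree) (hW : WildSplitPrintedInputsAtThree) :
    WildSplitEisensteinValueAtOneV ↔
    (∀ (W : WeierstrassCurve ℚ) [W.IsElliptic] [W.IsGloballyMinimal] (N : ℕ) [NeZero N] (K : Type) [Field K] [NumberField K] (Dt : Literature.NumberTheory.EllipticCurves.ModularForms.ModularParametrizationData W N) (H : Literature.NumberTheory.EllipticCurves.HeegnerDatum N (NumberField.discr K)) (ι : K →+* ℂ) (P : (W.baseChange K).toAffine.Point), Summit.BirchSwinnertonDyer.Rank1Residual.Additive.ClassO6 W 3 → W.HasSurjectiveModNGaloisRep 3 → W.analyticRank = 1 → W.conductorNorm ℤ = N → Literature.NumberTheory.EllipticCurves.IsImaginaryQuadratic K → Literature.NumberTheory.EllipticCurves.SatisfiesHeegnerHypothesis N K → (W.quadraticTwist (NumberField.discr K : ℚ)).entireLFunction 1 ≠ 0 → (WeierstrassCurve.Affine.Point.map ι.toRatAlgHom) P = Literature.NumberTheory.EllipticCurves.ModularForms.heegnerPointComplex Dt H → ¬ IsOfFinAddOrder P → Odd (NumberField.discr K) → Summit.BirchSwinnertonDyer.BirchSwinnertonDyer.Theorems.SchneiderFree.IndexLowerBoundLeAt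 W 3 K P (padicValNat 3 Dt.c.natAbs)) :=
  WildSplitEisensteinValueAtOneVIndexCurrency.valueAtOneV_iff_indexLowerBoundFH hF hW
    InputsPoitouTateSelmer.semiOrdinaryEisensteinDescent_poitouTateSelmerStructureDualityFact_proof
    (fun K _ _ ↦ PoitouTateShaTwoReadout.poitouTate_sha_tateDual_numberField K)

/-! ### §2 Step-L currency, PT-free and C-free: modulo {Kolyvagin, W} the crux IS `L₃ʷ°` -/

/-- **Modulo {Kolyvagin 1990 Thm A, `WildSplitPrintedInputsAtThree`}: `E_𝟙^V ↔ L₃ʷ°`** (the STEP-L socket at the Manin slack on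
the odd Friedberg–Hoffstein data) — p615634 §3 / p617759 §3 with crux C and both Poitou–Tate binders supplied by the tree.
Bookkeeping; nothing asserted about any curve. [cite: JetchevSkinnerWan2017, Thm. 3.3.1 and §7.4.1 (arXiv:1512.06894 pp. 11, 30)]
[cite: Castella2018, Thm. 2.3 and §5 (5.1)–(5.3)] [cite: Kolyvagin1990, Thm. A] -/
theorem valueAtOneV_iff_stepL
    (hKo : ∀ (N : ℕ) [NeZero N] (W : WeierstrassCurve ℚ) (K : Type) [Field K] [NumberField K],
      Literature.NumberTheory.EllipticCurves.kolyvagin N W K)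
    (hW : WildSplitPrintedInputsAtThree) :
    WildSplitEisensteinValueAtOneV ↔
      ∀ (W : WeierstrassCurve ℚ) [W.IsElliptic] [W.IsGloballyMinimal] (N : ℕ) [NeZero N] (K : Type) [Field K]
        [NumberField K] (Dt : ModularParametrizationData W N) (H : HeegnerDatum N (NumberField.discr K)) (ι : K →+* ℂ)
        (P : (W.baseChange K).toAffine.Point), ClassO6 W 3 → W.HasSurjectiveModNGaloisRep 3 → W.analyticRank = 1 →
        W.conductorNorm ℤ = N → IsImaginaryQuadratic K → SatisfiesHeegnerHypothesis N K →
        (W.quadraticTwist (NumberField.discr K : ℚ)).entireLFunction 1 ≠ 0 →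
        WeierstrassCurve.Affine.Point.map ι.toRatAlgHom P = heegnerPointComplex Dt H → ¬ IsOfFinAddOrder P →
        Odd (NumberField.discr K) → SchneiderFree.IndexLowerBoundLeAt W 3 K P (padicValNat 3 Dt.c.natAbs) :=
  WildSplitEisensteinValueAtOneVNecessityOfPrint.valueAtOneV_iff_stepL_of_print hKo hW
    InputsPoitouTateSelmer.semiOrdinaryEisensteinDescent_poitouTateSelmerStructureDualityFact_proof
    poitouTateShaTateDualFact_proof

/-! ### §3 Certificate road, PT-free: print + ONE Kolyvagin point-certificate per index-excess datum -/

/-- **`PublishedInputsWildThree → McCallum Cor. 5.6 (lower, printed mod-p hypothesis; named fact) → CERT₃^FH,all →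
WildSplitEisensteinValueAtOneV`, no tower split** — p623400 §7 with both Poitou–Tate binders supplied by the tree. On this road
the ONLY non-published input under crux #2″ is ONE Kolyvagin point-certificate per index-excess Friedberg–Hoffstein datum
(«`M_∞ ≤ ord₃(c·∏c_ℓ)`», Kolyvagin's conjecture at the additive 3 in McCallum's currency). CONDITIONAL on PUB, on the named
Literature fact `McCallum1991_pow_dvd_card_sha_primary_of_certificate_modP` and on the certificate statement; nothing asserted
about any curve. [cite: McCallumLMS1991, §5 Cor. 5.6 (p. 310)] [cite: WZhang2014, Thm. 1.1 and Remark 18]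
[cite: JetchevSkinnerWan2017, §7.4.1 (arXiv:1512.06894 p. 30)] -/
theorem valueAtOneV_of_certificates_modP (hF : PublishedInputsWildThree)
    (hMcP : Literature.NumberTheory.EllipticCurves.McCallum1991_pow_dvd_card_sha_primary_of_certificate_modP)
    (hCert : ∀ (W : WeierstrassCurve ℚ) [W.IsElliptic] [W.IsGloballyMinimal] (N : ℕ) [NeZero N] (K : Type) [Field K]
      [NumberField K] (Dt : Literature.NumberTheory.EllipticCurves.ModularForms.ModularParametrizationData W N)
      (H : Literature.NumberTheory.EllipticCurves.HeegnerDatum N (NumberField.discr K)) (ι : K →+* ℂ)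
      (P : (W.baseChange K).toAffine.Point),
      Summit.BirchSwinnertonDyer.Rank1Residual.Additive.ClassO6 W 3 → W.HasSurjectiveModNGaloisRep 3 →
      W.analyticRank = 1 → W.conductorNorm ℤ = N → Literature.NumberTheory.EllipticCurves.IsImaginaryQuadratic K →
      Literature.NumberTheory.EllipticCurves.SatisfiesHeegnerHypothesis N K →
      (W.quadraticTwist (NumberField.discr K : ℚ)).entireLFunction 1 ≠ 0 →
      (WeierstrassCurve.Affine.Point.map ι.toRatAlgHom) P =
        Literature.NumberTheory.EllipticCurves.ModularForms.heegnerPointComplex Dt H →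
      ¬ IsOfFinAddOrder P → Odd (NumberField.discr K) →
      padicValNat 3 W.tamagawaProduct + padicValNat 3 Dt.c.natAbs < padicValNat 3 (AddSubgroup.zmultiples P).index →
      ∃ (n : ℕ) (d : Literature.NumberTheory.EllipticCurves.KolyvaginHeegnerData Dt H.β ι n),
        Squarefree n ∧
        (∀ ℓ ∈ n.primeFactors,
          Literature.NumberTheory.EllipticCurves.Zhang2014.IsKolyvaginPrime N W K 3 ℓ ∧
          padicValNat 3 W.tamagawaProduct + padicValNat 3 Dt.c.natAbs + 1 ≤
            Literature.NumberTheory.EllipticCurves.Zhang2014.kolyvaginIndex W 3 ℓ) ∧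
        ¬ Summit.BirchSwinnertonDyer.Rank1Residual.X11b.Three.Koly.PDiv d 3
            (padicValNat 3 W.tamagawaProduct + padicValNat 3 Dt.c.natAbs + 1)) :
    WildSplitEisensteinValueAtOneV :=
  WildSplitEisensteinValueAtOneVCertificateRoadModP.valueAtOneV_of_certificates_modP_of_poitouTate hF hMcP hCert
    InputsPoitouTateSelmer.semiOrdinaryEisensteinDescent_poitouTateSelmerStructureDualityFact_proof
    (fun K _ _ ↦ PoitouTateShaTwoReadout.poitouTate_sha_tateDual_numberField K)

/-! ### §4 ℚ-level currency and the rung, PT-free -/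

/-- **Modulo {PUB, W, Z}: `E_𝟙^V ↔ [∀ cell W, MissingLowerBoundAt W 3]`** — the ℚ-level normal form p618985 §4 with both
Poitou–Tate binders supplied by the tree: crux #2″ is exactly the `r = 1` Eisenstein (lower) half of BSD₃ on the onto wild cell.
Bookkeeping; nothing asserted about any curve. [cite: JetchevSkinnerWan2017, Thm. 3.3.1 and §7.4.1 (arXiv:1512.06894 pp. 11, 30)]
[cite: Miller2011LMS, Def. 1.1 (arXiv:1010.2431 p. 3)] -/
theorem valueAtOneV_iff_lowerHalf (hF : PublishedInputsWildThree) (hW : WildSplitPrintedInputsAtThree)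
    (hZ : WildRankZeroTwistAtThree) :
    WildSplitEisensteinValueAtOneV ↔
      ∀ (W : WeierstrassCurve ℚ) [W.IsElliptic] [W.IsGloballyMinimal], ClassO6 W 3 → W.HasSurjectiveModNGaloisRep 3 →
        W.analyticRank = 1 → MissingLowerBoundAt W 3 :=
  WildSplitEisensteinValueAtOneVLowerHalf.valueAtOneV_iff_lowerHalf hF hW
    InputsPoitouTateSelmer.semiOrdinaryEisensteinDescent_poitouTateSelmerStructureDualityFact_proof
    poitouTateShaTateDualFact_proof hZ

/-- **Modulo {PUB, W, Z}: `WAllExclAddWildRankOneSurj ↔ E_𝟙^V ∧ [∀ cell W, MissingUpperBoundAt W 3]`** — p618985 §6 with both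
Poitou–Tate binders supplied by the tree. Bookkeeping; BSD₃ is proved for no curve.
[cite: JetchevSkinnerWan2017, §7.4.1 (arXiv:1512.06894 p. 30)] [cite: Miller2011LMS, Def. 1.1 (arXiv:1010.2431 p. 3)] -/
theorem wAllExclAddWildRankOneSurj_iff_valueAtOneV_and_upperHalf (hF : PublishedInputsWildThree)
    (hW : WildSplitPrintedInputsAtThree) (hZ : WildRankZeroTwistAtThree) :
    Summit.BirchSwinnertonDyer.WAllExclAddWildRankOneSurj ↔
      WildSplitEisensteinValueAtOneV ∧
      (∀ (W : WeierstrassCurve ℚ) [W.IsElliptic] [W.IsGloballyMinimal], ClassO6 W 3 → W.HasSurjectiveModNGaloisRep 3 →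
        W.analyticRank = 1 → MissingUpperBoundAt W 3) :=
  WildSplitEisensteinValueAtOneVLowerHalf.wAllExclAddWildRankOneSurj_iff_valueAtOneV_and_upperHalf hF hW
    InputsPoitouTateSelmer.semiOrdinaryEisensteinDescent_poitouTateSelmerStructureDualityFact_proof
    poitouTateShaTateDualFact_proof hZ

/-- **Necessity, PT-free: `PublishedInputsWildThree → WildRankZeroTwistAtThree → WAllExclAddWildRankOneSurj → E_𝟙^V`** —
p617759 §4 with both Poitou–Tate binders supplied by the tree: given print and the rank-zero leaf Z, the rung itself implies
crux #2″, so a refutation of `E_𝟙^V` refutes BSD₃ on the wild O6 rows given print. CONDITIONAL; nothing asserted about any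
curve. [cite: JetchevSkinnerWan2017, §7.4.1 (arXiv:1512.06894 p. 30)] [cite: GrossZagier1986, Thm. I.(6.3) and (7.3)] -/
theorem valueAtOneV_of_wAllExclAddWildRankOneSurj (hF : PublishedInputsWildThree) (hZ : WildRankZeroTwistAtThree)
    (hleaf : Summit.BirchSwinnertonDyer.WAllExclAddWildRankOneSurj) : WildSplitEisensteinValueAtOneV :=
  WildSplitEisensteinValueAtOneVNecessityOfPrint.valueAtOneV_of_wAllExclAddWildRankOneSurj_of_poitouTate hF
    InputsPoitouTateSelmer.semiOrdinaryEisensteinDescent_poitouTateSelmerStructureDualityFact_proof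
    poitouTateShaTateDualFact_proof hZ
    hleaf

/-- **Modulo the route's remaining `closes` content {PUB 20389, Prims 25896, J‴ 25898, W 24476, Z 20387}:
`WAllExclAddWildRankOneSurj ↔ E_𝟙^V`** — p617759 §5 with both Poitou–Tate binders AND the Jetchev max-form binder (item 25897, CLOSED·proved
11:23Z, consumed inside soed-p2-w3 g6's six-binder kernel `EisensteinKernelAtThreeOfValueAtOneVSlim`) supplied by the tree. ⇒ is the necessity
above (uses PUB, Z only); ⇐ is the slim kernel by name. After 2026-08-28 the route's open content is exactly {E_𝟙^V (= I_FH mod print), J‴, Z}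
plus print {PUB, Prims, W}; no duality or glue input remains. CONDITIONAL on every listed package; nothing asserted about any curve.
[cite: JetchevSkinnerWan2017, Thm. 3.3.1 and §7.4.1 (arXiv:1512.06894 pp. 11, 30)] [cite: McCallumLMS1991, §3]
[cite: GrossLMS1991, Prop. 3.7(2) and §6] [cite: Jetchev2008, Thm. 1.4] -/
theorem wAllExclAddWildRankOneSurj_iff_valueAtOneV_of_binders (hF : PublishedInputsWildThree)
    (hPr : KolyvaginPrimitivesAtThree) (hJ : WildSigmaDivisibilityAtThreeMultiCarrier) (hW : WildSplitPrintedInputsAtThree)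
    (hZ : WildRankZeroTwistAtThree) :
    Summit.BirchSwinnertonDyer.WAllExclAddWildRankOneSurj ↔ WildSplitEisensteinValueAtOneV :=
  ⟨valueAtOneV_of_wAllExclAddWildRankOneSurj hF hZ, fun hE1V ↦
    EisensteinKernelAtThreeOfValueAtOneVSlim.wAllExclAddWildRankOneSurj_of_valueAtOneV_of_primitives_of_sigmaMultiCarrier hF
      hE1V hPr hJ hW hZ⟩

end Summit.BirchSwinnertonDyer.BirchSwinnertonDyer.Theorems.WildSplitEisensteinValueAtOneVPTFree

end
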